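import HarnessLib
import Summits.RiemannHypothesis.RiemannHypothesis.Theorems.SignConeSlackCertificateFourFifths
import Summits.RiemannHypothesis.RiemannHypothesis.Theorems.SignConeUnitSlackReduction

/-!
# Route SignCone: the unit-slack sign-cone inequality UNCONDITIONALLY up to the cut-off `a ≤ 4/5`

Items stmt-RiemannHypothesis-16302 `SignConeOscillatory` (crux) and stmt-RiemannHypothesis-16301
`SignConeInequality` (target) of route `SignCone` ask, for EVERY cut-off `a > 0`, that
`-Re F(0) ≤ Re W_ar(F)` for all node-nonnegative `F = Σᵢ gᵢ ⋆ g̃ᵢ` in the Weil cone `P(a)`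
(`W_ar` = polar + archimedean part of the explicit formula). As filed (all cut-offs) both are
RH-strength (`signConeOscillatory_iff_riemannHypothesis_of_coneMagnification`,
`SignConeSignConeOscillatoryConeFeasible.lean`); the unconditional content is the RUNG `a ≤ b`.
The tree's rung was `b = 563/1024 ≈ 0.55` (`signConeOscillatory_upTo_certb`, a corollary of
EXACT Weil positivity with the first prime, margin `3.8·10⁻⁸`).

Here the rung is pushed to `b = 4/5`, by a different mechanism that is native to the slack:
NO prime/node information is used at all (fake weight `c = 0`), although the nodes
`log 2, log 3, log 4` lie inside the window `(-2b, 2b)`. The analytic input is the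
kernel-checked slack certificate `weilArchQuadratic_ge_neg_weilNorm2Sq_of_tsupport_subset`
(`SignConeSlackCertificateFourFifths.lean`): `E(g) ≥ -‖g‖₂²` for Weil tests supported in
`[-4/5, 4/5]`, `E = weilArchQuadratic` = `Re W_ar(g ⋆ g̃)`
(`re_weilArchPolar_weilConv_weilReflect_eq_weilArchQuadratic`). Summing over `i` and using
`Re F(0) = Σ ‖gᵢ‖₂²` gives the inequality (`SignConeUnitSlackReduction.lean` with `c = 0`):

* `neg_re_apply_zero_le_re_weilArchPolar_of_tsupport_subset_four_fifths` — Literature form, any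
  finite family supported in `[-4/5, 4/5]`, no node hypothesis needed;
* `signConeInequality_upTo_four_fifths`, `signConeOscillatory_upTo_four_fifths` — the bodies of
  the route items VERBATIM (Mathlib primitives, `M`-form) with the extra hypothesis `a ≤ 4/5`.

Numerically `c = 0` works up to `b ≈ 0.84` (`inf E/‖g‖₂² = -1` there, odd sector); beyond, fake
prime weights `c ≈ Λ` restore a margin `≈ 1` at every cut-off (evidence RUNGS-unit-slack-certificates.md
on the item), which is the format of the next rungs.
-/

noncomputable section

-- `Summit.RiemannHypothesis.RiemannHypothesis.…` repeats a namespace component by design (D-0017 layout).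
set_option linter.dupNamespace false

open scoped BigOperators ComplexConjugate
open Complex MeasureTheory Set Filter

namespace Summit.RiemannHypothesis.RiemannHypothesis.Theorems.SignCone

open Literature.NumberTheory.LFunctions

/-- `W_ar(g ⋆ g̃) = E(g)` as complex numbers: the polar + archimedean part of the explicit formula at
an autocorrelation is Yoshida's analytic form (no support hypothesis; Yoshida (2.1)/(6.2)). [folklore] -/
theorem weilArchPolar_weilConv_weilReflect_eq_weilArchQuadratic {g : ℝ → ℂ} (hg : IsWeilTest g) :
    weilPolarTerm (weilConv g (weilReflect g)) + weilArchTerm (weilConv g (weilReflect g)) =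
      (weilArchQuadratic g : ℂ) := by
  unfold weilArchTerm weilArchQuadratic
  rw [weilPolarTerm_weilConv_weilReflect hg, weilArchIntegral_weilConv_weilReflect hg,
    weilConv_weilReflect_apply_zero]
  push_cast
  ring

/-- `Re W_ar(g ⋆ g̃) = E(g)`. [folklore] -/
theorem re_weilArchPolar_weilConv_weilReflect_eq_weilArchQuadratic {g : ℝ → ℂ} (hg : IsWeilTest g) :
    (weilPolarTerm (weilConv g (weilReflect g)) + weilArchTerm (weilConv g (weilReflect g))).re =
      weilArchQuadratic g := by
  rw [weilArchPolar_weilConv_weilReflect_eq_weilArchQuadratic hg, Complex.ofReal_re]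

/-- **The antecedent of `ConeMagnification` at cut-off `4/5` with the ZERO fake weight**:
`-‖g‖₂² ≤ Re (W_ar(g ⋆ g̃) - P_0(g ⋆ g̃))` for every Weil test `g` supported in `[-4/5, 4/5]`
(kernel-checked slack certificate; `P_0 = 0`). [folklore] -/
theorem fakeWeight_zero_unitSlack_four_fifths :
    ∀ g : ℝ → ℂ, IsWeilTest g → tsupport g ⊆ Icc (-(4 / 5 : ℝ)) (4 / 5) →
      -(∫ t, ‖g t‖ ^ 2) ≤ (weilPolarTerm (weilConv g (weilReflect g)) + weilArchTerm (weilConv g (weilReflect g)) -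
        ∑' n : ℕ, (((fun _ : ℕ => (0 : ℝ)) n : ℝ) : ℂ) / (Real.sqrt n : ℂ) *
          (weilConv g (weilReflect g) (Real.log n) + weilConv g (weilReflect g) (-Real.log n))).re := by
  intro g hg hsupp
  simp only [Complex.ofReal_zero, zero_div, zero_mul, tsum_zero, sub_zero]
  rw [re_weilArchPolar_weilConv_weilReflect_eq_weilArchQuadratic hg]
  exact weilArchQuadratic_ge_neg_weilNorm2Sq_of_tsupport_subset le_rfl hg hsupp

/-- **The unit-slack sign-cone inequality up to `4/5`, Literature form.** For every finite family of
Weil tests `gᵢ` supported in `[-b, b]`, `b ≤ 4/5`, and `F = Σᵢ gᵢ ⋆ g̃ᵢ` node-nonnegative: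
`-Re F(0) ≤ Re W_ar(F)`. (The node hypothesis is only spent on `P_0 = 0 ≥ 0`, i.e. not at all.) [folklore] -/
theorem neg_re_apply_zero_le_re_weilArchPolar_of_tsupport_subset_four_fifths {b : ℝ} (hb : b ≤ 4 / 5)
    {k : ℕ} {g : Fin k → ℝ → ℂ} {F : ℝ → ℂ} (hF : F = fun t => ∑ i, weilConv (g i) (weilReflect (g i)) t)
    (hg : ∀ i, IsWeilTest (g i)) (hsupp : ∀ i, tsupport (g i) ⊆ Icc (-b) b)
    (hn : ∀ n : ℕ, 2 ≤ n → 0 ≤ (F (Real.log n)).re) :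
    -(F 0).re ≤ (weilPolarTerm F + weilArchTerm F).re :=
  neg_re_apply_zero_le_re_weilArchPolar_of_fakeWeight_unitSlack (b := 4 / 5) (c := fun _ => 0)
    (fun _ => le_rfl) fakeWeight_zero_unitSlack_four_fifths hF hg
    (fun i => (hsupp i).trans (Icc_subset_Icc (neg_le_neg hb) hb)) hn

/-- **`SignConeInequality` (route target, stmt-RiemannHypothesis-16301) UNCONDITIONALLY for all
cut-offs `a ≤ 4/5`** — the item's body verbatim with the extra hypothesis `a ≤ 4/5`. [folklore] -/
theorem signConeInequality_upTo_four_fifths :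
    ∀ a : ℝ, 0 < a → a ≤ 4 / 5 → ∀ (k : ℕ) (g : Fin k → ℝ → ℂ), (∀ i, (ContDiff ℝ ((⊤ : ℕ∞) : WithTop ℕ∞) (g i) ∧ HasCompactSupport (g i)) ∧ tsupport (g i) ⊆ Set.Icc (-a) a) → let F : ℝ → ℂ := fun t => ∑ i, MeasureTheory.convolution (g i) (fun u => (starRingEnd ℂ) ((g i) (-u))) (ContinuousLinearMap.mul ℂ ℂ) MeasureTheory.MeasureSpace.volume t; (∀ n : ℕ, 2 ≤ n → 0 ≤ (F (Real.log n)).re) → let M : ℂ → ℂ := fun s => ∫ u : ℝ, F u * Complex.exp ((s - 1 / 2) * u); -(F 0).re ≤ (M 0 + M 1 + ((1 / (2 * Real.pi) : ℂ) * (∫ t : ℝ, M (1 / 2 + t * Complex.I) * ((Complex.digamma (1 / 4 + t / 2 * Complex.I)).re : ℂ)) - F 0 * (Real.log Real.pi : ℂ))).re := by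
  intro a _ha hab k g hg F hn M
  exact neg_re_apply_zero_le_re_weilArchPolar_of_tsupport_subset_four_fifths (b := a) hab (g := g) (F := F)
    rfl (fun i => (hg i).1) (fun i => (hg i).2) hn

/-- **`SignConeOscillatory` (route crux, stmt-RiemannHypothesis-16302) UNCONDITIONALLY for all
cut-offs `a ≤ 4/5`** — the item's body verbatim with the extra hypothesis `a ≤ 4/5` (the oscillation
hypothesis is not used). Previous unconditional range: `a ≤ 563/1024` (`signConeOscillatory_upTo_certb`). [folklore] -/
theorem signConeOscillatory_upTo_four_fifths :
    ∀ a : ℝ, 0 < a → a ≤ 4 / 5 → ∀ (k : ℕ) (g : Fin k → ℝ → ℂ), (∀ i, (ContDiff ℝ ((⊤ : ℕ∞) : WithTop ℕ∞) (g i) ∧ HasCompactSupport (g i)) ∧ tsupport (g i) ⊆ Set.Icc (-a) a) → let F : ℝ → ℂ := fun t => ∑ i, MeasureTheory.convolution (g i) (fun u => (starRingEnd ℂ) ((g i) (-u))) (ContinuousLinearMap.mul ℂ ℂ) MeasureTheory.MeasureSpace.volume t; (∀ n : ℕ, 2 ≤ n → 0 ≤ (F (Real.log n)).re) → (∃ t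 : ℝ, Real.log 2 ≤ |t| ∧ (F t).re < 0) → let M : ℂ → ℂ := fun s => ∫ u : ℝ, F u * Complex.exp ((s - 1 / 2) * u); -(F 0).re ≤ (M 0 + M 1 + ((1 / (2 * Real.pi) : ℂ) * (∫ t : ℝ, M (1 / 2 + t * Complex.I) * ((Complex.digamma (1 / 4 + t / 2 * Complex.I)).re : ℂ)) - F 0 * (Real.log Real.pi : ℂ))).re :=
  signConeOscillatory_upTo_of_fakeWeight_unitSlack (b := 4 / 5) (c := fun _ => 0) (fun _ => le_rfl)
    fakeWeight_zero_unitSlack_four_fifths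

/-- The rung in terms of `log`: the unit-slack sign-cone inequality holds for every cut-off
`a ≤ log 2` (indeed `log 2 < 4/5`), i.e. for all `F ∈ P(a)` with window `(-2a, 2a) ⊆ (-log 4, log 4)`. [folklore] -/
theorem signConeOscillatory_upTo_log_two :
    ∀ a : ℝ, 0 < a → a ≤ Real.log 2 → ∀ (k : ℕ) (g : Fin k → ℝ → ℂ), (∀ i, (ContDiff ℝ ((⊤ : ℕ∞) : WithTop ℕ∞) (g i) ∧ HasCompactSupport (g i)) ∧ tsupport (g i) ⊆ Set.Icc (-a) a) → let F : ℝ → ℂ := fun t => ∑ i, MeasureTheory.convolution (g i) (fun u => (starRingEnd ℂ) ((g i) (-u))) (ContinuousLinearMap.mul ℂ ℂ) MeasureTheory.MeasureSpace.volume t; (∀ n : ℕ, 2 ≤ n → 0 ≤ (F (Real.log n)).re) → (∃ t : ℝ, Real.log 2 ≤ |t| ∧ (F t).re < 0) → let M : ℂ → ℂ := fun s => ∫ u : ℝ, F u * Complex.exp ((s - 1 / 2) * u); -(F 0).re ≤ (M 0 + M 1 + ((1 / (2 * Real.pi) : ℂ) * (∫ t : ℝ, M (1 / 2 + t * Complex.I)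 * ((Complex.digamma (1 / 4 + t / 2 * Complex.I)).re : ℂ)) - F 0 * (Real.log Real.pi : ℂ))).re := by
  intro a ha hal
  have h2 : Real.log 2 ≤ 4 / 5 := by
    have := Real.log_two_lt_d9
    linarith
  exact signConeOscillatory_upTo_four_fifths a ha (hal.trans h2)

end Summit.RiemannHypothesis.RiemannHypothesis.Theorems.SignCone

end
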